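import Summits.HodgeConjecture.CorCM.Hyp413.A3Liu413RogawskiFaceTypes
import Summits.HodgeConjecture.HodgeConjecture.Theorems.A3Liu413StubG2Holds
import Summits.HodgeConjecture.HodgeConjecture.Theorems.A3Liu413DictionaryStubsByName
import Summits.HodgeConjecture.CorCM.Hyp413.A3Liu413LabelSeparation
import Summits.HodgeConjecture.HodgeConjecture.Theorems.HCCMUnconditionalHD3OfFacts
import Summits.HodgeConjecture.CorCM.HypD3.A4LiuD3LineRigidityS6a
import Summits.HodgeConjecture.CorCM.HypD1pp.A4LiuD1ppHeadOfFacts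
import Literature.RepresentationTheory.MoeglinVignerasWaldspurger1987.RankOneThetaLiftLinesDisjointHolds
import Literature.RepresentationTheory.MoeglinVignerasWaldspurger1987.RankOneThetaLiftTwistRigidityHolds
import Literature.RepresentationTheory.MoeglinVignerasWaldspurger1987.RankOneThetaLiftTwistRigiditySplitHolds
import Literature.RepresentationTheory.MoeglinVignerasWaldspurger1987.RankOneThetaLiftIrreducibleProofs
import Literature.NumberTheory.Automorphic.Liu2021.SplitPlaceOscillatorModelUniform
import Literature.NumberTheory.Automorphic.Zelevinsky1980.UnitaryCharacterInductionIrreducible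
import Literature.NumberTheory.QuadraticForms.PrescribedNormClassesCM
import HarnessLib

/-!
# T4 ⇐ FLOOR: the guarded parity rule `StubFTF2iff'` of the Rogawski line from the floor rows III-2 (a)∃ (`hdictE`) and III-2 (c)⇐ (`hocc`),
# the sign dictionary G2 (★ `stubG2_holds`) and label rigidity under the cofinite guard

Topic: summit `HodgeConjecture`, sub-problem `HodgeConjecture`, route `HCCMUnconditional`, crux `H413` (item stmt-HodgeConjecture-24833;
registry of record `Cruxes/H413/Lines/a3_liu413.lean` v10.1, served T4 stub `stub_FTF2iff' : StubFTF2iff'` :410).  PROVER FILE (cell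
hodgecm-mathlib, D-0151, fan B-III (T4); seat B-p14, KEY `t4-kc-ftf2iff-of-floor` (B-plan2 g4, director g4 RULING s61); `--supports
stmt-HodgeConjecture-24833`): theorems only, sorry-free, axioms ⊆ trio, namespace `Summit.HodgeConjecture.HodgeConjecture.Theorems`.

WHAT THIS IS — AND IS NOT.  `StubFTF2iff'` is [Rogawski1990, Thm. 14.6.4 + R₂]'s parity rule for the inner form at the pin, GUARDED by [Liu2021, Def. 4.11]'s
proviso `EpsCofinite t` (a trace-formula statement, FACT ∞ from Mathlib: ROG-SPEC §2).  What is proved here is the implication **T4 ⇐ FLOOR**: the served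
stub FOLLOWS from the floor's rows III-2 (a)∃ (`hdictE`, every irreducible constituent of the pin's `H¹_{B,τ'}` is `≅ ω_V(t')` for an admissible weight-one
`t'`) and III-2 (c)⇐ (`hocc`, every admissible weight-one `ω_V(t)` occurs), the CLOSED sign dictionary G2 (★ `stubG2_holds`: «admissible ⟺ `Parity`»), and
LABEL RIGIDITY at the pin for weight-one triples ([Liu2021, App. D Lem. D.1 (1), (3)] per place — THEOREMS of the tree: `lemD1AllPairs_of_facts` at every
pair `(ε, χ)`, `lemD1_3AsPrintedI_famAtV_of_facts` on any indexed family) read under the COFINITE GUARD through B-p04's ★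
`QuadraticForms.exists_prescribed_normClass_of_finite` (a cofinite `ε` IS a global class family, so the pin's line `r ε` is honest: `locF (r ε) = ε`).
It shrinks item 24833's served set and certifies that the T4 edition asks NO MORE than the floor; it does NOT reduce the floor
{hF1e, hdictE, hJ3a, hocc, hFal, h415} and adds no citation.  The floor-reducing direction (FLOOR ⇐ Rogawski's trace formula) stays the B-III DAG.
HC_CM is proved only modulo the 7 printed citations until rung 0 closes.

* (⇐) `Parity t` ⇒ `t.IsAdmissible` (`stubG2_holds … |>.mpr`) ⇒ `ω_V(t)` occurs (`hocc`, [Liu2021, l. 2145 «conversely»]) — S.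
* (⇒) `ω_V(t)` occurs, `t` cofinite of weight one ⇒ `ω_V(t)` is irreducible ([Lem. D.1 (1)] at the pair `(ε_t, χ_t)` — available at EVERY pair, admissible or
  not — + `Def411WeilCarriers.rhoAtLine_isIrreducible_of_lemD1AsPrinted`), hence `≅ ω_V(t')` for an admissible weight-one `t'` (`hdictE`); the two labels then
  AGREE: `μ_t = μ_{t'}` (weak approximation after `forall_localMu_eq_of_equiv_of_lemD1AsPrintedI`), `χ_t = χ_{t'}` and `locF (r ε_t) = locF (r ε_{t'})`
  (`locF_eq_and_chi_eq_of_equiv_of_lemD1AsPrintedI`) — the separation engines of `A3Liu413LabelSeparation` run on the WEIGHT-ONE triples instead of the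
  admissible ones, their [Lem. D.1 (3)] row supplied on that family by the closed `famAtV` producer and their [Lem. D.1 (1)] rows by `lemD1AllPairs_of_facts` —
  and both lines are honest (`t` cofinite: B-p04; `t'` admissible: `exists_locF_eq_epsOf`), so `ε_t = ε_{t'}`, `t = t'`, `t` is admissible and `Parity t` (G2 ⇒).
  This is REF1's junk-`ε` analysis (2026-08-28T12:49:36Z) run forward: WITHOUT the guard the last step is false.

## References
* [Rogawski1990] J. D. Rogawski, Ann. of Math. Stud. 123 (1990), Thm. 14.6.4 (p. 244), §15.3.  [Rogawski1992] Thm. 1.1.  [Marshall2014] §3.4.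
* [Liu2021] Y. Liu, Camb. J. Math. 9 (2021) = arXiv:2102.11518: Def. 4.11 (l. 2088), Def. 4.12 (ll. 2102–2108), proof of Prop. 4.13 (l. 2145), Thm. 4.18 (2)
  with proof l. 2270, App. D Lem. D.1 (1), (3) (l. 5229, 5233).
* [GelbartRogawski1991] Invent. Math. 105 (1991), Intro p. 447 L6–8, Thm. 5.1.1.  [Omeara1963] 71:19.  [FlathCorvallis1979] Thm. 3.
-/

set_option autoImplicit false

-- `Summit.HodgeConjecture.HodgeConjecture.Theorems` is the mandated namespace (single-problem summit: Problem = Summit), which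
-- `linter.dupNamespace` flags; the lakefile turns the linter off tree-wide (weak option), restated here so stand-alone elaboration is
-- warning-free too.
set_option linter.dupNamespace false

noncomputable section

namespace Summit.HodgeConjecture.HodgeConjecture.Theorems

open scoped TensorProduct Matrix
open NumberField NumberField.InfinitePlace
open HodgeCM.Model HodgeCM.Model.LiuIndex HodgeCM.Model.TowerCarrier
open Summit.HodgeConjecture.CorCM
open Summit.HodgeConjecture.CorCM.Model
open Literature.AlgebraicGeometry.Motives (CMType)
open Literature.AlgebraicGeometry.HodgeTheory Literature.NumberTheory.Automorphic.PicardCM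
open Literature.AlgebraicGeometry.ShimuraVarieties Literature.AlgebraicGeometry.ShimuraVarieties.UnitaryCanonicalModel
open Literature.NumberTheory.ComplexMultiplication
open Literature.NumberTheory.Automorphic
open Literature.NumberTheory.Automorphic.IdeleClassGroup (toHeckeCharacter isUnitary_toHeckeCharacter galConj)
open Literature.NumberTheory.Automorphic.Liu2021 Literature.NumberTheory.Automorphic.Liu2021.AppendixC
open Literature.NumberTheory.Automorphic.Liu2021.AppendixC.RestOne
open Literature.NumberTheory.Automorphic.Liu2021.Def411WeilCarriers (lineOf locF Rep)
open Summit.HodgeConjecture.CorCM.Transposition.OmegaTransport (realUnit)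
open HodgeCM.Model.ArchSideTerm (e₁)
open Literature.NumberTheory.GelbartRogawski1991 Literature.NumberTheory.GelbartRogawski1991.UnitaryDualPair
open Literature.NumberTheory.GelbartRogawski1991.UnitaryDualPair.LocalSplitting (localMu norm_localMu continuous_localMu localMu_toLocalRing_eq_one_iff
  eq_of_forall_localMu_toHeckeCharacter_eq)
open Literature.RepresentationTheory Literature.RepresentationTheory.Liu2021
open Summit.HodgeConjecture.CorCM.Transposition
open Summit.HodgeConjecture.CorCM.Lines.A3Liu413
open Summit.HodgeConjecture.CorCM.D2Bridge.MuKeyIdentLemD3End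
open Literature.NumberTheory.GelbartRogawski1991.OscillatorTripleDictionary (OccursInH1 IsIsoToOmega rhoTriple)
open scoped DirectSum

/-! ## §1 (⇐): `Parity t` ⇒ `ω_V(t)` occurs — G2 (⇐) then the floor row III-2 (c)⇐ -/

set_option synthInstance.maxHeartbeats 400000 in
set_option maxHeartbeats 8000000 in
/-- **(⇐) of `StubFTF2iff'` from the floor**: at `n = 3`, for every `τ'` and every triple `t` of the pin (no weight or guard hypothesis is needed for this
direction beyond what the row asks), `Parity t` ⇒ `t` is `μ`-admissible (the sign dictionary G2, ★ `stubG2_holds`, (⇐)) ⇒ `ω_V(t)` occurs in the pin's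
`H¹_{B,τ'}(A_∞, ℂ)` (floor row III-2 (c)⇐ `hocc` = `GelbartRogawski1991.admissible_occursInH1` at the printed datum, [Liu2021, l. 2145 «conversely»]).
[cite: Liu2021, proof of Prop. 4.13 (l. 2145); Def. 4.12 (ll. 2102–2108)] [cite: Rogawski1990, Thm. 14.6.4 (p. 244)] -/
theorem stubFTF2iff'_mpr_of_floor
    (hocc :
    ∀ (hDel : Literature.AlgebraicGeometry.ShimuraVarieties.UnitaryCanonicalModel.canonicalModel_exists_printed)
      (F : HodgeCM.CMField) [IsGalois ℚ F] (h6 : 6 ≤ Module.finrank ℚ F) {ι₁ : F →+* ℂ} (V : HodgeCM.HermSpace3 F ι₁) (a₀ : RealScalar F)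
      (Φ : CMType F) (hΦ : ι₁ ∈ Φ.1) (i : (I V (repAt a₀) (muLiu ι₁ GramClass.rep))),
      admissible_occursInH1 (((uniformOmegaRep (Summit.HodgeConjecture.CorCM.DelRec.exists_recordSystem_of_printed hDel) ⟨HodgeCM.CMField.K F⟩ ι₁ ⟨HodgeCM.HermSpace3.Hm V, HodgeCM.HermSpace3.isHermitian V, HodgeCM.HermSpace3.signature_ι₁ V, HodgeCM.HermSpace3.posDef_of_ne V⟩ Φ e₁ (frameD V) (frameD_real V) (frameD_ne V) (ιVE V) (2 * imagUnit (HodgeCM.CMField.K F))⁻¹ (fun _ _ => (Rep.update ↥(maximalRealSubfield (HodgeCM.CMField.K F)) (imagUnitSq (HodgeCM.CMField.K F)) (Rep.ofLineOf ↥(maximalRealSubfield (HodgeCM.CMField.K F)) (imagUnitSq (HodgeCM.CMField.K F))) (locF ↥(maximalRealSubfield (HodgeCM.CMField.K F)) (imagUnitSq (HodgeCM.CMField.K F)) (realUnit ⟨HodgeCM.CMField.K F⟩ (repAt a₀ (Sigma.fst i)).1 (repAt a₀ (Sigma.fst i)).2.1 (repAt a₀ (Sigma.fst i)).2.2)) (realUnit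 ⟨HodgeCM.CMField.K F⟩ (repAt a₀ (Sigma.fst i)).1 (repAt a₀ (Sigma.fst i)).2.1 (repAt a₀ (Sigma.fst i)).2.2) rfl)))).prop413Data ((liuDictionaryPin exists_isReal_hodgeModel_holds hodgePQ_independent_of_hodgeModel_holds BallQuotient.ballQuotientUniformised_holds (cmAbelianVarietyRealised_of_eigenbasis exists_isReal_hodgeModel_holds hodgePQ_independent_of_hodgeModel_holds cmAbelianVarietyEigenbasisRealised_holds) Literature.NumberTheory.Transcendental.arapura2012_cor_15_4_6_holds V (I V (repAt a₀) (muLiu ι₁ GramClass.rep)) (line V (repAt a₀) (muLiu ι₁ GramClass.rep)))).H)) :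
    ∀ (hDel : Literature.AlgebraicGeometry.ShimuraVarieties.UnitaryCanonicalModel.canonicalModel_exists_printed)
      (F : HodgeCM.CMField) [IsGalois ℚ F] (h6 : 6 ≤ Module.finrank ℚ F) {ι₁ : F →+* ℂ} (V : HodgeCM.HermSpace3 F ι₁) (a₀ : RealScalar F)
      (Φ : CMType F) (hΦ : ι₁ ∈ Φ.1) (i : (I V (repAt a₀) (muLiu ι₁ GramClass.rep))),
      (datum413 hDel F V a₀ Φ i).n = 3 → ∀ (τ' : HodgeCM.CMField.K F →+* ℂ) (t : (datum413 hDel F V a₀ Φ i).Triple), t.HasWeightOne →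
        Parity hDel F V a₀ Φ i t → OccursInH1 (datum413 hDel F V a₀ Φ i) τ' (rhoTriple (datum413 hDel F V a₀ Φ i) t) := by
  intro hDel F _ h6 ι₁ V a₀ Φ hΦ i hn τ' t hw hpar
  exact hocc hDel F h6 V a₀ Φ hΦ i hn τ' t hw ((stubG2_holds hDel F h6 V a₀ Φ hΦ i t).mpr hpar)

/-! ## §2 [Liu2021, App. D Lem. D.1 (3)] AS PRINTED on ANY indexed family at the frame `e₁` — a THEOREM of the tree (the `hD3` engine's input shape) -/

section LemD13Generic

open Summit.HodgeConjecture.CorCM.HypD3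
open Summit.HodgeConjecture.CorCM.Lines.A4LiuD3 (famAtV)

-- heartbeats as in `HypD3.hypD3_of_facts` (one monolithic composition over the a4-liuD3 line's five thirds).
set_option maxHeartbeats 4000000 in
/-- **[Liu2021, App. D Lem. D.1 (3)] AS PRINTED per finite place on an ARBITRARY indexed family `famAtV F e₁ dV … ψ aOf χOf v`** (index type `ι`,
characters `ψ`, lines `aOf`, centre characters `χOf` free) — ZERO hypotheses: the composition of `HypD3.lemD1_3AsPrintedI_famAtV_of_facts` (the a4-liuD3 line's
five thirds) with every residual fact CLOSED by name, exactly as in the closed chain `HD3_proof` (★ p613567) = `hD3_of_twistRigidity` ∘ `hD3_of_lineRigidityS6a` ∘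
`hypD3_of_facts`: S6a `HypD3.lineRigidityS6a` (B-p14) through B-p18's `kudla_of_lineRigidity` and B-p09's `isoOfParams_of_lineRigidityS6a`, IV-4 (c1)
`rankOne_theta_lines_disjoint_holds`, (c3) `rankOne_theta_twist_rigidity_holds`, (c3-split) `rankOne_theta_twist_rigidity_split_holds`, IV-3
`splitPlace_chiCoinv_iso_parabolicIndGL_holds` / `parabolicIndGL_detChar_unitary_isIrreducible_holds`.  The END row `HypD3` is this theorem at ONE index
family (the admissible indices); the separation below needs it on the WEIGHT-ONE triples.
[cite: Liu2021, App. D Lem. D.1 (3) (l. 5233), proof l. 5253–5255] [cite: MoeglinVignerasWaldspurger1987, Chap. 3 IV.4] [cite: Kudla1994, Thm. 3.1] -/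
theorem lemD1_3AsPrintedI_famAtV_holds (F : HodgeCM.CMField) (dV : Fin 3 → (F : Type))
    (hdV : ∀ i, IsCMField.complexConj (F : Type) (dV i) = dV i) (hdV0 : ∀ i, dV i ≠ 0) {ι : Type}
    (ψ : ι → (Literature.NumberTheory.Automorphic.IdeleClassGroup (F : Type) →ₜ* Circle))
    (hψ : ∀ t, IdeleClassGroup.IsConjugateSymplectic (F : Type) (ψ t))
    (aOf : ι → (↥(maximalRealSubfield (F : Type)))ˣ)
    (χOf : ι → Def411WeilCarriers.Chi ↥(maximalRealSubfield (F : Type)) (F : Type) (IsCMField.complexConj (F : Type)))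
    (v : IsDedekindDomain.HeightOneSpectrum (𝓞 ↥(maximalRealSubfield (F : Type)))) :
    LemD1_3AsPrintedI (famAtV F e₁ dV hdV hdV0 ψ hψ aOf χOf v) :=
  lemD1_3AsPrintedI_famAtV_of_facts
    sameClassChiOfIsoNonsplit
    (fun h41 h43 F dV hdV hdV0 {_ι} ψ hψ aOf χOf v =>
      muOfIsoNonsplit_of_facts h41 h43 F dV hdV hdV0 ψ hψ aOf χOf v
        (fun i j => kudla_of_lineRigidity F dV hdV hdV0 ψ hψ aOf v i j (lineRigidityS6a F dV hdV hdV0 ψ hψ aOf v i j)))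
    (fun h4 F dV hdV hdV0 {_ι} ψ hψ aOf χOf v =>
      splitInjective_of_facts h4
        Literature.NumberTheory.Automorphic.Liu2021.splitPlace_chiCoinv_iso_parabolicIndGL_holds
        Literature.NumberTheory.Automorphic.Zelevinsky1980.parabolicIndGL_detChar_unitary_isIrreducible_holds.{0}
        F dV hdV hdV0 ψ hψ aOf χOf v
        (fun i j => kudla_of_lineRigidity F dV hdV hdV0 ψ hψ aOf v i j (lineRigidityS6a F dV hdV hdV0 ψ hψ aOf v i j)))
    (fun F => sameClassOfSplit F e₁)
    (isoOfParams_of_lineRigidityS6a lineRigidityS6a)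
    Literature.RepresentationTheory.MoeglinVignerasWaldspurger1987.rankOne_theta_lines_disjoint_holds
    Literature.RepresentationTheory.MoeglinVignerasWaldspurger1987.rankOne_theta_twist_rigidity_holds
    Literature.RepresentationTheory.MoeglinVignerasWaldspurger1987.rankOne_theta_twist_rigidity_split_holds
    F dV hdV hdV0 ψ hψ aOf χOf v

end LemD13Generic

/-! ## §3 `ω_V(t)` is IRREDUCIBLE for EVERY weight-one triple `t` of the pin ([Lem. D.1 (1)] at the pair `(ε_t, χ_t)`, admissible or not) -/

set_option synthInstance.maxHeartbeats 400000 in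
set_option maxHeartbeats 8000000 in
/-- **[Liu2021, Def. 4.11] «irreducible» at EVERY weight-one triple of the printed datum `P = datum413 hDel F V a₀ Φ i`** (admissible or not): `ω_V(t) =
rhoTriple P t` is irreducible — `Def411WeilCarriers.rhoAtLine_isIrreducible_of_lemD1AsPrinted` (restricted tensor product of irreducible local types,
`ιVE V` onto) fed with [App. D Lem. D.1 (1)] AS PRINTED at the pair `(ε_t, χ_t)`, which the tree PROVES at every pair (`HypD1pp.lemD1AllPairs_of_facts` over
IV-1a `mvw_IV4_rankOne_irreducibleOrZero_holds`, IV-3 `splitPlace_chiCoinv_iso_parabolicIndGL_holds` / `parabolicIndGL_detChar_unitary_isIrreducible_holds`).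
Sibling of `Hyp413.isIrreducible_rhoAt_datum413_of_hypD1pp` (admissible indices, row as hypothesis).  HC_CM is proved only modulo the 7 printed citations.
[cite: Liu2021, Def. 4.11 (l. 2092–2096); App. D Lem. D.1 (1) (l. 5229, 5246–5253)] [cite: GelbartRogawski1991, §3.1 Prop. 3.1.1 p. 455]
[cite: MoeglinVignerasWaldspurger1987, Chap. 3 IV.4] -/
theorem isIrreducible_rhoTriple_datum413
    (hDel : Literature.AlgebraicGeometry.ShimuraVarieties.UnitaryCanonicalModel.canonicalModel_exists_printed)
    (F : HodgeCM.CMField) [IsGalois ℚ F] (h6 : 6 ≤ Module.finrank ℚ F) {ι₁ : F →+* ℂ} (V : HodgeCM.HermSpace3 F ι₁) (a₀ : RealScalar F)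
    (Φ : CMType F) (hΦ : ι₁ ∈ Φ.1) (i : (I V (repAt a₀) (muLiu ι₁ GramClass.rep))) (t : (datum413 hDel F V a₀ Φ i).Triple) (hw : t.HasWeightOne) :
    (rhoTriple (datum413 hDel F V a₀ Φ i) t).IsIrreducible := by
  exact Def411WeilCarriers.rhoAtLine_isIrreducible_of_lemD1AsPrinted ↥(maximalRealSubfield (F : Type)) (F : Type) (IsCMField.complexConj (F : Type)) 3 e₁
    (Matrix.diagonal (frameD V)) (complexConj_imagUnit (F : Type)) (imagUnit_ne_zero (F : Type)) (imagUnit_mul_self (F : Type))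
    (realDiagonal_isSymm (F : Type) (frameD V) (frameD_real V)) (isUnit_det_realDiagonal (F : Type) (frameD V) (frameD_real V) (frameD_ne V))
    (realDiagonal_map (F : Type) (frameD V) (frameD_real V)).symm
    (OmegaChiSplitting.hsChiD ⟨HodgeCM.CMField.K F⟩ e₁ (frameD V) (frameD_real V) (frameD_ne V) (toHeckeCharacter (F : Type) t.μ)
      (isUnitary_toHeckeCharacter (F : Type) t.μ) ((isOscillatorChar_toHeckeCharacter_iff t.μ).mpr t.isConjugateSymplectic))
    ((Rep.update ↥(maximalRealSubfield (HodgeCM.CMField.K F)) (imagUnitSq (HodgeCM.CMField.K F)) (Rep.ofLineOf ↥(maximalRealSubfield (HodgeCM.CMField.K F)) (imagUnitSq (HodgeCM.CMField.K F))) (locF ↥(maximalRealSubfield (HodgeCM.CMField.K F)) (imagUnitSq (HodgeCM.CMField.K F)) (realUnit ⟨HodgeCM.CMField.K F⟩ (repAt a₀ (Sigma.fst i)).1 (repAt a₀ (Sigma.fst i)).2.1 (repAt a₀ (Sigma.fst i)).2.2)) (realUnit ⟨HodgeCM.CMField.K F⟩ (repAt a₀ (Sigma.fst i)).1 (repAt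 a₀ (Sigma.fst i)).2.1 (repAt a₀ (Sigma.fst i)).2.2) rfl).toFun t.ε) t.χ
    (OmegaChiSplitting.chiLocalSplittingsD ⟨HodgeCM.CMField.K F⟩ e₁ (frameD V) (frameD_real V) (frameD_ne V) (toHeckeCharacter (F : Type) t.μ)
      ((isOscillatorChar_toHeckeCharacter_iff t.μ).mpr t.isConjugateSymplectic) ((Rep.update ↥(maximalRealSubfield (HodgeCM.CMField.K F)) (imagUnitSq (HodgeCM.CMField.K F)) (Rep.ofLineOf ↥(maximalRealSubfield (HodgeCM.CMField.K F)) (imagUnitSq (HodgeCM.CMField.K F))) (locF ↥(maximalRealSubfield (HodgeCM.CMField.K F)) (imagUnitSq (HodgeCM.CMField.K F)) (realUnit ⟨HodgeCM.CMField.K F⟩ (repAt a₀ (Sigma.fst i)).1 (repAt a₀ (Sigma.fst i)).2.1 (repAt a₀ (Sigma.fst i)).2.2)) (realUnit ⟨HodgeCM.CMField.K F⟩ (repAt a₀ (Sigma.fst i)).1 (repAt a₀ (Sigma.fst i)).2.1 (repAt a₀ (Sigma.fst i)).2.2) rfl).toFun t.ε))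
    (ι := ιVE V) (UnitaryDualPair.finPart_cmKTypeHom_finAdelicToAdelic_surjective (F : Type) V.Hm (frameG V) (frameD V) (frame_congr V))
    (OmegaChiSplitting.hfac_sChiD ⟨HodgeCM.CMField.K F⟩ e₁ (frameD V) (frameD_real V) (frameD_ne V) (toHeckeCharacter (F : Type) t.μ)
      (isUnitary_toHeckeCharacter (F : Type) t.μ) ((isOscillatorChar_toHeckeCharacter_iff t.μ).mpr t.isConjugateSymplectic) ((Rep.update ↥(maximalRealSubfield (HodgeCM.CMField.K F)) (imagUnitSq (HodgeCM.CMField.K F)) (Rep.ofLineOf ↥(maximalRealSubfield (HodgeCM.CMField.K F)) (imagUnitSq (HodgeCM.CMField.K F))) (locF ↥(maximalRealSubfield (HodgeCM.CMField.K F)) (imagUnitSq (HodgeCM.CMField.K F)) (realUnit ⟨HodgeCM.CMField.K F⟩ (repAt a₀ (Sigma.fst i)).1 (repAt a₀ (Sigma.fst i)).2.1 (repAt a₀ (Sigma.fst i)).2.2)) (realUnit ⟨HodgeCM.CMField.K F⟩ (repAt a₀ (Sigma.fst i)).1 (repAt a₀ (Sigma.fst i)).2.1 (repAt a₀ (Sigma.fst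 i)).2.2) rfl).toFun t.ε))
    (le_refl 3) (localMu (F : Type) (toHeckeCharacter (F : Type) t.μ))
    (fun v x => norm_localMu (F : Type) (toHeckeCharacter (F : Type) t.μ) v (isUnitary_toHeckeCharacter (F : Type) t.μ) x)
    (continuous_localMu (F : Type) (toHeckeCharacter (F : Type) t.μ))
    (fun v x => localMu_toLocalRing_eq_one_iff (F : Type) (toHeckeCharacter (F : Type) t.μ) v
      ((isOscillatorChar_toHeckeCharacter_iff t.μ).mpr t.isConjugateSymplectic) x)
    (fun v => Summit.HodgeConjecture.CorCM.HypD1pp.lemD1AllPairs_of_facts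
      Literature.RepresentationTheory.MoeglinVignerasWaldspurger1987.mvw_IV4_rankOne_irreducibleOrZero_holds
      Literature.NumberTheory.Automorphic.Liu2021.splitPlace_chiCoinv_iso_parabolicIndGL_holds
      Literature.NumberTheory.Automorphic.Zelevinsky1980.parabolicIndGL_detChar_unitary_isIrreducible_holds.{0}
      hDel F h6 V (repAt a₀ (Sigma.fst i)) Φ hΦ t.μ t.isConjugateSymplectic hw t.ε t.χ v)

/-! ## §4 LABEL RIGIDITY at the pin for WEIGHT-ONE triples (admissible or not): `ω_V(s) ≅ ω_V(t)`, `ω_V(s) ≠ 0` ⇒ `μ_s = μ_t`, the lines of `ε_s`, `ε_t`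
agree locally everywhere, `χ_s = χ_t` -/

set_option synthInstance.maxHeartbeats 400000 in
set_option maxHeartbeats 8000000 in
/-- **Label rigidity at the pin for WEIGHT-ONE triples** (admissible or not) — [Liu2021, Thm. 4.18 (2)]'s separation argument («follows from Lemma D.1»,
l. 2270) run on the family of ALL weight-one triples of `P = datum413 hDel F V a₀ Φ i` instead of the admissible ones (sibling of
`Lines.A3Liu413.sep_admTriple_datum413_of_hypD3_hypD1pp`, same engines): two weight-one triples `s, t` with `ω_V(s) ≠ 0` and a `U(V)(𝔸_{F⁺,f})`-equivariant
`ℂ`-linear `ω_V(s) ≃ ω_V(t)` have the same `μ` (`Def411WeilCarriers.forall_localMu_eq_of_equiv_of_lemD1AsPrintedI` + weak approximation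
`eq_of_forall_localMu_toHeckeCharacter_eq`), the same `χ`, and `ε`-LINES in the same local norm class everywhere (`locF (r ε_s) = locF (r ε_t)`,
`Def411WeilCarriers.locF_eq_and_chi_eq_of_equiv_of_lemD1AsPrintedI`); the rows [Lem. D.1 (1)] (per index) and [Lem. D.1 (3)] (on the weight-one family) are the
THEOREMS `HypD1pp.lemD1AllPairs_of_facts` and `lemD1_3AsPrintedI_famAtV_holds` (§2).  The `ε`-labels themselves agree only when both lines are honest
(REF1 2026-08-28T12:49:36Z) — see §5.  HC_CM is proved only modulo the 7 printed citations.
[cite: Liu2021, Thm. 4.18 (2) (l. 2241) with proof l. 2270; App. D Lemma D.1 (1), (3) (l. 5229, 5233); Def. 4.11–4.12]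
[cite: FlathCorvallis1979, Theorem 3 (uniqueness clause)] [cite: CasselsFrohlichANT1967, Ch. VII §8] -/
theorem sep_weightOne_datum413
    (hDel : Literature.AlgebraicGeometry.ShimuraVarieties.UnitaryCanonicalModel.canonicalModel_exists_printed)
    (F : HodgeCM.CMField) [IsGalois ℚ F] (h6 : 6 ≤ Module.finrank ℚ F) {ι₁ : F →+* ℂ} (V : HodgeCM.HermSpace3 F ι₁) (a₀ : RealScalar F)
    (Φ : CMType F) (hΦ : ι₁ ∈ Φ.1) (i : (I V (repAt a₀) (muLiu ι₁ GramClass.rep))) (s t : (datum413 hDel F V a₀ Φ i).Triple)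
    (hws : s.HasWeightOne) (hwt : t.HasWeightOne)
    (hs : Nontrivial ((datum413 hDel F V a₀ Φ i).omega s.μ s.isConjugateSymplectic s.ε s.χ))
    (hst : ∃ f : (datum413 hDel F V a₀ Φ i).omega s.μ s.isConjugateSymplectic s.ε s.χ ≃ₗ[ℂ]
        (datum413 hDel F V a₀ Φ i).omega t.μ t.isConjugateSymplectic t.ε t.χ,
      ∀ (g : (datum413 hDel F V a₀ Φ i).G) (x : (datum413 hDel F V a₀ Φ i).omega s.μ s.isConjugateSymplectic s.ε s.χ),
        f (rhoTriple (datum413 hDel F V a₀ Φ i) s g x) = rhoTriple (datum413 hDel F V a₀ Φ i) t g (f x)) :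
    s.μ = t.μ ∧
      locF ↥(maximalRealSubfield (HodgeCM.CMField.K F)) (imagUnitSq (HodgeCM.CMField.K F)) ((Rep.update ↥(maximalRealSubfield (HodgeCM.CMField.K F)) (imagUnitSq (HodgeCM.CMField.K F)) (Rep.ofLineOf ↥(maximalRealSubfield (HodgeCM.CMField.K F)) (imagUnitSq (HodgeCM.CMField.K F))) (locF ↥(maximalRealSubfield (HodgeCM.CMField.K F)) (imagUnitSq (HodgeCM.CMField.K F)) (realUnit ⟨HodgeCM.CMField.K F⟩ (repAt a₀ (Sigma.fst i)).1 (repAt a₀ (Sigma.fst i)).2.1 (repAt a₀ (Sigma.fst i)).2.2)) (realUnit ⟨HodgeCM.CMField.K F⟩ (repAt a₀ (Sigma.fst i)).1 (repAt a₀ (Sigma.fst i)).2.1 (repAt a₀ (Sigma.fst i)).2.2) rfl).toFun s.ε) =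
        locF ↥(maximalRealSubfield (HodgeCM.CMField.K F)) (imagUnitSq (HodgeCM.CMField.K F)) ((Rep.update ↥(maximalRealSubfield (HodgeCM.CMField.K F)) (imagUnitSq (HodgeCM.CMField.K F)) (Rep.ofLineOf ↥(maximalRealSubfield (HodgeCM.CMField.K F)) (imagUnitSq (HodgeCM.CMField.K F))) (locF ↥(maximalRealSubfield (HodgeCM.CMField.K F)) (imagUnitSq (HodgeCM.CMField.K F)) (realUnit ⟨HodgeCM.CMField.K F⟩ (repAt a₀ (Sigma.fst i)).1 (repAt a₀ (Sigma.fst i)).2.1 (repAt a₀ (Sigma.fst i)).2.2)) (realUnit ⟨HodgeCM.CMField.K F⟩ (repAt a₀ (Sigma.fst i)).1 (repAt a₀ (Sigma.fst i)).2.1 (repAt a₀ (Sigma.fst i)).2.2) rfl).toFun t.ε) ∧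
      s.χ = t.χ := by
  -- the `μ`-leg on the WEIGHT-ONE family (restriction [Flath Thm 3], local types from [Lem. D.1 (1)] at every pair, local separation from [Lem. D.1 (3)]),
  -- then weak approximation
  have keyμ := Def411WeilCarriers.forall_localMu_eq_of_equiv_of_lemD1AsPrintedI (ι := {k : (datum413 hDel F V a₀ Φ i).Triple // k.HasWeightOne})
      ↥(maximalRealSubfield (F : Type)) (F : Type) (IsCMField.complexConj (F : Type)) 3 e₁ (Matrix.diagonal (frameD V))
      (complexConj_imagUnit (F : Type)) (imagUnit_ne_zero (F : Type)) (imagUnit_mul_self (F : Type))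
      (realDiagonal_isSymm (F : Type) (frameD V) (frameD_real V)) (isUnit_det_realDiagonal (F : Type) (frameD V) (frameD_real V) (frameD_ne V))
      (realDiagonal_map (F : Type) (frameD V) (frameD_real V)).symm (le_refl 3)
      (fun k => (Rep.update ↥(maximalRealSubfield (HodgeCM.CMField.K F)) (imagUnitSq (HodgeCM.CMField.K F)) (Rep.ofLineOf ↥(maximalRealSubfield (HodgeCM.CMField.K F)) (imagUnitSq (HodgeCM.CMField.K F))) (locF ↥(maximalRealSubfield (HodgeCM.CMField.K F)) (imagUnitSq (HodgeCM.CMField.K F)) (realUnit ⟨HodgeCM.CMField.K F⟩ (repAt a₀ (Sigma.fst i)).1 (repAt a₀ (Sigma.fst i)).2.1 (repAt a₀ (Sigma.fst i)).2.2)) (realUnit ⟨HodgeCM.CMField.K F⟩ (repAt a₀ (Sigma.fst i)).1 (repAt a₀ (Sigma.fst i)).2.1 (repAt a₀ (Sigma.fst i)).2.2) rfl).toFun k.1.ε) (fun k => k.1.χ)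
      (fun k => OmegaChiSplitting.chiLocalSplittingsD ⟨HodgeCM.CMField.K F⟩ e₁ (frameD V) (frameD_real V) (frameD_ne V) (toHeckeCharacter (F : Type) k.1.μ)
        ((isOscillatorChar_toHeckeCharacter_iff k.1.μ).mpr k.1.isConjugateSymplectic) ((Rep.update ↥(maximalRealSubfield (HodgeCM.CMField.K F)) (imagUnitSq (HodgeCM.CMField.K F)) (Rep.ofLineOf ↥(maximalRealSubfield (HodgeCM.CMField.K F)) (imagUnitSq (HodgeCM.CMField.K F))) (locF ↥(maximalRealSubfield (HodgeCM.CMField.K F)) (imagUnitSq (HodgeCM.CMField.K F)) (realUnit ⟨HodgeCM.CMField.K F⟩ (repAt a₀ (Sigma.fst i)).1 (repAt a₀ (Sigma.fst i)).2.1 (repAt a₀ (Sigma.fst i)).2.2)) (realUnit ⟨HodgeCM.CMField.K F⟩ (repAt a₀ (Sigma.fst i)).1 (repAt a₀ (Sigma.fst i)).2.1 (repAt a₀ (Sigma.fst i)).2.2) rfl).toFun k.1.ε))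
      (fun k => localMu (F : Type) (toHeckeCharacter (F : Type) k.1.μ))
      (fun k v x => norm_localMu (F : Type) (toHeckeCharacter (F : Type) k.1.μ) v (isUnitary_toHeckeCharacter (F : Type) k.1.μ) x)
      (fun k => continuous_localMu (F : Type) (toHeckeCharacter (F : Type) k.1.μ))
      (fun k v x => localMu_toLocalRing_eq_one_iff (F : Type) (toHeckeCharacter (F : Type) k.1.μ) v
        ((isOscillatorChar_toHeckeCharacter_iff k.1.μ).mpr k.1.isConjugateSymplectic) x)
      (fun k a => OmegaChiSplitting.hsChiD ⟨HodgeCM.CMField.K F⟩ e₁ (frameD V) (frameD_real V) (frameD_ne V) (toHeckeCharacter (F : Type) k.1.μ)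
        (isUnitary_toHeckeCharacter (F : Type) k.1.μ) ((isOscillatorChar_toHeckeCharacter_iff k.1.μ).mpr k.1.isConjugateSymplectic) a)
      (fun k => OmegaChiSplitting.hfac_sChiD ⟨HodgeCM.CMField.K F⟩ e₁ (frameD V) (frameD_real V) (frameD_ne V) (toHeckeCharacter (F : Type) k.1.μ)
        (isUnitary_toHeckeCharacter (F : Type) k.1.μ) ((isOscillatorChar_toHeckeCharacter_iff k.1.μ).mpr k.1.isConjugateSymplectic) ((Rep.update ↥(maximalRealSubfield (HodgeCM.CMField.K F)) (imagUnitSq (HodgeCM.CMField.K F)) (Rep.ofLineOf ↥(maximalRealSubfield (HodgeCM.CMField.K F)) (imagUnitSq (HodgeCM.CMField.K F))) (locF ↥(maximalRealSubfield (HodgeCM.CMField.K F)) (imagUnitSq (HodgeCM.CMField.K F)) (realUnit ⟨HodgeCM.CMField.K F⟩ (repAt a₀ (Sigma.fst i)).1 (repAt a₀ (Sigma.fst i)).2.1 (repAt a₀ (Sigma.fst i)).2.2)) (realUnit ⟨HodgeCM.CMField.K F⟩ (repAt a₀ (Sigma.fst i)).1 (repAt a₀ (Sigma.fst i)).2.1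 (repAt a₀ (Sigma.fst i)).2.2) rfl).toFun k.1.ε))
      (fun k v => Summit.HodgeConjecture.CorCM.HypD1pp.lemD1AllPairs_of_facts
        Literature.RepresentationTheory.MoeglinVignerasWaldspurger1987.mvw_IV4_rankOne_irreducibleOrZero_holds
        Literature.NumberTheory.Automorphic.Liu2021.splitPlace_chiCoinv_iso_parabolicIndGL_holds
        Literature.NumberTheory.Automorphic.Zelevinsky1980.parabolicIndGL_detChar_unitary_isIrreducible_holds.{0}
        hDel F h6 V (repAt a₀ (Sigma.fst i)) Φ hΦ k.1.μ k.1.isConjugateSymplectic k.2 k.1.ε k.1.χ v)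
      (fun v => lemD1_3AsPrintedI_famAtV_holds F (frameD V) (frameD_real V) (frameD_ne V)
        (fun k : {k : (datum413 hDel F V a₀ Φ i).Triple // k.HasWeightOne} => k.1.μ) (fun k => k.1.isConjugateSymplectic)
        (fun k => (Rep.update ↥(maximalRealSubfield (HodgeCM.CMField.K F)) (imagUnitSq (HodgeCM.CMField.K F)) (Rep.ofLineOf ↥(maximalRealSubfield (HodgeCM.CMField.K F)) (imagUnitSq (HodgeCM.CMField.K F))) (locF ↥(maximalRealSubfield (HodgeCM.CMField.K F)) (imagUnitSq (HodgeCM.CMField.K F)) (realUnit ⟨HodgeCM.CMField.K F⟩ (repAt a₀ (Sigma.fst i)).1 (repAt a₀ (Sigma.fst i)).2.1 (repAt a₀ (Sigma.fst i)).2.2)) (realUnit ⟨HodgeCM.CMField.K F⟩ (repAt a₀ (Sigma.fst i)).1 (repAt a₀ (Sigma.fst i)).2.1 (repAt a₀ (Sigma.fst i)).2.2) rfl).toFun k.1.ε) (fun k => k.1.χ) v)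
      (UnitaryDualPair.finPart_cmKTypeHom_finAdelicToAdelic_surjective (F : Type) V.Hm (frameG V) (frameD V) (frame_congr V))
      ⟨s, hws⟩ ⟨t, hwt⟩ hs hst
  -- the `ε`- and `χ`-legs on the same family
  have key2 := Def411WeilCarriers.locF_eq_and_chi_eq_of_equiv_of_lemD1AsPrintedI (ι := {k : (datum413 hDel F V a₀ Φ i).Triple // k.HasWeightOne})
      ↥(maximalRealSubfield (F : Type)) (F : Type) (IsCMField.complexConj (F : Type)) 3 (Matrix.diagonal (frameD V))
      (complexConj_imagUnit (F : Type)) (imagUnit_ne_zero (F : Type)) e₁ (imagUnit_mul_self (F : Type))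
      (realDiagonal_isSymm (F : Type) (frameD V) (frameD_real V)) (isUnit_det_realDiagonal (F : Type) (frameD V) (frameD_real V) (frameD_ne V))
      (realDiagonal_map (F : Type) (frameD V) (frameD_real V)).symm (le_refl 3)
      (fun k => (Rep.update ↥(maximalRealSubfield (HodgeCM.CMField.K F)) (imagUnitSq (HodgeCM.CMField.K F)) (Rep.ofLineOf ↥(maximalRealSubfield (HodgeCM.CMField.K F)) (imagUnitSq (HodgeCM.CMField.K F))) (locF ↥(maximalRealSubfield (HodgeCM.CMField.K F)) (imagUnitSq (HodgeCM.CMField.K F)) (realUnit ⟨HodgeCM.CMField.K F⟩ (repAt a₀ (Sigma.fst i)).1 (repAt a₀ (Sigma.fst i)).2.1 (repAt a₀ (Sigma.fst i)).2.2)) (realUnit ⟨HodgeCM.CMField.K F⟩ (repAt a₀ (Sigma.fst i)).1 (repAt a₀ (Sigma.fst i)).2.1 (repAt a₀ (Sigma.fst i)).2.2) rfl).toFun k.1.ε) (fun k => k.1.χ)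
      (fun k => OmegaChiSplitting.chiLocalSplittingsD ⟨HodgeCM.CMField.K F⟩ e₁ (frameD V) (frameD_real V) (frameD_ne V) (toHeckeCharacter (F : Type) k.1.μ)
        ((isOscillatorChar_toHeckeCharacter_iff k.1.μ).mpr k.1.isConjugateSymplectic) ((Rep.update ↥(maximalRealSubfield (HodgeCM.CMField.K F)) (imagUnitSq (HodgeCM.CMField.K F)) (Rep.ofLineOf ↥(maximalRealSubfield (HodgeCM.CMField.K F)) (imagUnitSq (HodgeCM.CMField.K F))) (locF ↥(maximalRealSubfield (HodgeCM.CMField.K F)) (imagUnitSq (HodgeCM.CMField.K F)) (realUnit ⟨HodgeCM.CMField.K F⟩ (repAt a₀ (Sigma.fst i)).1 (repAt a₀ (Sigma.fst i)).2.1 (repAt a₀ (Sigma.fst i)).2.2)) (realUnit ⟨HodgeCM.CMField.K F⟩ (repAt a₀ (Sigma.fst i)).1 (repAt a₀ (Sigma.fst i)).2.1 (repAt a₀ (Sigma.fst i)).2.2) rfl).toFun k.1.ε))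
      (fun k => localMu (F : Type) (toHeckeCharacter (F : Type) k.1.μ))
      (fun k v x => norm_localMu (F : Type) (toHeckeCharacter (F : Type) k.1.μ) v (isUnitary_toHeckeCharacter (F : Type) k.1.μ) x)
      (fun k => continuous_localMu (F : Type) (toHeckeCharacter (F : Type) k.1.μ))
      (fun k v x => localMu_toLocalRing_eq_one_iff (F : Type) (toHeckeCharacter (F : Type) k.1.μ) v
        ((isOscillatorChar_toHeckeCharacter_iff k.1.μ).mpr k.1.isConjugateSymplectic) x)
      (fun k a => OmegaChiSplitting.hsChiD ⟨HodgeCM.CMField.K F⟩ e₁ (frameD V) (frameD_real V) (frameD_ne V) (toHeckeCharacter (F : Type) k.1.μ)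
        (isUnitary_toHeckeCharacter (F : Type) k.1.μ) ((isOscillatorChar_toHeckeCharacter_iff k.1.μ).mpr k.1.isConjugateSymplectic) a)
      (fun k => OmegaChiSplitting.hfac_sChiD ⟨HodgeCM.CMField.K F⟩ e₁ (frameD V) (frameD_real V) (frameD_ne V) (toHeckeCharacter (F : Type) k.1.μ)
        (isUnitary_toHeckeCharacter (F : Type) k.1.μ) ((isOscillatorChar_toHeckeCharacter_iff k.1.μ).mpr k.1.isConjugateSymplectic) ((Rep.update ↥(maximalRealSubfield (HodgeCM.CMField.K F)) (imagUnitSq (HodgeCM.CMField.K F)) (Rep.ofLineOf ↥(maximalRealSubfield (HodgeCM.CMField.K F)) (imagUnitSq (HodgeCM.CMField.K F))) (locF ↥(maximalRealSubfield (HodgeCM.CMField.K F)) (imagUnitSq (HodgeCM.CMField.K F)) (realUnit ⟨HodgeCM.CMField.K F⟩ (repAt a₀ (Sigma.fst i)).1 (repAt a₀ (Sigma.fst i)).2.1 (repAt a₀ (Sigma.fst i)).2.2)) (realUnit ⟨HodgeCM.CMField.K F⟩ (repAt a₀ (Sigma.fst i)).1 (repAt a₀ (Sigma.fst i)).2.1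 (repAt a₀ (Sigma.fst i)).2.2) rfl).toFun k.1.ε))
      (fun k v => Summit.HodgeConjecture.CorCM.HypD1pp.lemD1AllPairs_of_facts
        Literature.RepresentationTheory.MoeglinVignerasWaldspurger1987.mvw_IV4_rankOne_irreducibleOrZero_holds
        Literature.NumberTheory.Automorphic.Liu2021.splitPlace_chiCoinv_iso_parabolicIndGL_holds
        Literature.NumberTheory.Automorphic.Zelevinsky1980.parabolicIndGL_detChar_unitary_isIrreducible_holds.{0}
        hDel F h6 V (repAt a₀ (Sigma.fst i)) Φ hΦ k.1.μ k.1.isConjugateSymplectic k.2 k.1.ε k.1.χ v)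
      (fun v => lemD1_3AsPrintedI_famAtV_holds F (frameD V) (frameD_real V) (frameD_ne V)
        (fun k : {k : (datum413 hDel F V a₀ Φ i).Triple // k.HasWeightOne} => k.1.μ) (fun k => k.1.isConjugateSymplectic)
        (fun k => (Rep.update ↥(maximalRealSubfield (HodgeCM.CMField.K F)) (imagUnitSq (HodgeCM.CMField.K F)) (Rep.ofLineOf ↥(maximalRealSubfield (HodgeCM.CMField.K F)) (imagUnitSq (HodgeCM.CMField.K F))) (locF ↥(maximalRealSubfield (HodgeCM.CMField.K F)) (imagUnitSq (HodgeCM.CMField.K F)) (realUnit ⟨HodgeCM.CMField.K F⟩ (repAt a₀ (Sigma.fst i)).1 (repAt a₀ (Sigma.fst i)).2.1 (repAt a₀ (Sigma.fst i)).2.2)) (realUnit ⟨HodgeCM.CMField.K F⟩ (repAt a₀ (Sigma.fst i)).1 (repAt a₀ (Sigma.fst i)).2.1 (repAt a₀ (Sigma.fst i)).2.2) rfl).toFun k.1.ε) (fun k => k.1.χ) v)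
      (UnitaryDualPair.finPart_cmKTypeHom_finAdelicToAdelic_surjective (F : Type) V.Hm (frameG V) (frameD V) (frame_congr V))
      ⟨s, hws⟩ ⟨t, hwt⟩ hs hst
  exact ⟨eq_of_forall_localMu_toHeckeCharacter_eq (F : Type) s.μ t.μ keyμ, key2.1, key2.2⟩

/-! ## §5 HONEST LINES: a cofinite `ε` (the guard `EpsCofinite`) and an admissible `ε` are both global class families, so the pin's section `r` recovers them -/

set_option synthInstance.maxHeartbeats 400000 in
set_option maxHeartbeats 8000000 in
/-- **Under the guard the line is honest**: if `{v | ε_t v ≠ 1}` is finite (`EpsCofinite t`, [Liu2021, Def. 4.11 (l. 2088)]'s proviso), then `ε_t = locF a` for a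
global `a ∈ (K⁺)ˣ` — B-p04's ★ `QuadraticForms.exists_prescribed_normClass_of_finite` (O'Meara 71:19 with a free real sign at one real place of the totally
real `K⁺`; `d = imagUnit²` is negative at every real place).  This is exactly the step that FAILS for a junk `ε` (REF1 2026-08-28T12:49:36Z).
[cite: Liu2021, Def. 4.11 (l. 2088); Def. 4.12 (l. 2105)] [cite: Omeara1963, 71:19, 71:19a] -/
theorem exists_locF_eq_of_epsCofinite
    (hDel : Literature.AlgebraicGeometry.ShimuraVarieties.UnitaryCanonicalModel.canonicalModel_exists_printed)
    (F : HodgeCM.CMField) [IsGalois ℚ F] {ι₁ : F →+* ℂ} (V : HodgeCM.HermSpace3 F ι₁) (a₀ : RealScalar F)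
    (Φ : CMType F) (i : (I V (repAt a₀) (muLiu ι₁ GramClass.rep))) (t : (datum413 hDel F V a₀ Φ i).Triple) (hfin : EpsCofinite hDel F V a₀ Φ i t) :
    ∃ a : (↥(maximalRealSubfield (HodgeCM.CMField.K F)))ˣ,
      locF ↥(maximalRealSubfield (HodgeCM.CMField.K F)) (imagUnitSq (HodgeCM.CMField.K F)) a = t.ε := by
  obtain ⟨w₀⟩ := (inferInstance : Nonempty (InfinitePlace ↥(maximalRealSubfield (HodgeCM.CMField.K F))))
  obtain ⟨θ, hθ⟩ := Literature.NumberTheory.QuadraticForms.exists_prescribed_normClass_of_finite ↥(maximalRealSubfield (HodgeCM.CMField.K F))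
    (imagUnitSq (HodgeCM.CMField.K F))
    (ne_zero_of_coe_eq_mul_self (imagUnit_ne_zero (HodgeCM.CMField.K F)) (imagUnit_mul_self (HodgeCM.CMField.K F)).symm)
    (embedding_of_isReal_lt_zero_of_coe_eq_mul_self (complexConj_imagUnit (HodgeCM.CMField.K F))
      (imagUnit_ne_zero (HodgeCM.CMField.K F)) (imagUnit_mul_self (HodgeCM.CMField.K F)).symm)
    w₀ (IsTotallyReal.isReal w₀) t.ε hfin
  exact ⟨θ, funext fun v => hθ v⟩

set_option synthInstance.maxHeartbeats 400000 in
set_option maxHeartbeats 8000000 in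
/-- **An admissible `ε` is a global class family** ([Liu2021, Def. 4.12]: `ε = epsOf e` for an admissible `e ∈ K^{×−}`, and `epsOf e = locF a` by
`Def411WeilCarriers.exists_locF_eq_epsOf`). [cite: Liu2021, Def. 4.12 (ll. 2102–2108)] -/
theorem exists_locF_eq_of_isAdmissible
    (hDel : Literature.AlgebraicGeometry.ShimuraVarieties.UnitaryCanonicalModel.canonicalModel_exists_printed)
    (F : HodgeCM.CMField) [IsGalois ℚ F] {ι₁ : F →+* ℂ} (V : HodgeCM.HermSpace3 F ι₁) (a₀ : RealScalar F)
    (Φ : CMType F) (i : (I V (repAt a₀) (muLiu ι₁ GramClass.rep))) (t : (datum413 hDel F V a₀ Φ i).Triple) (hadm : t.IsAdmissible) :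
    ∃ a : (↥(maximalRealSubfield (HodgeCM.CMField.K F)))ˣ,
      locF ↥(maximalRealSubfield (HodgeCM.CMField.K F)) (imagUnitSq (HodgeCM.CMField.K F)) a = t.ε := by
  obtain ⟨x, -, hx⟩ := hadm
  obtain ⟨a, ha⟩ := Def411WeilCarriers.exists_locF_eq_epsOf ↥(maximalRealSubfield (HodgeCM.CMField.K F)) (HodgeCM.CMField.K F)
    (imagUnitSq (HodgeCM.CMField.K F)) (2 * imagUnit (HodgeCM.CMField.K F))⁻¹ x
  exact ⟨a, ha.trans hx⟩

/-! ## §6 THE HEAD: `StubFTF2iff'` from the floor rows `hdictE`, `hocc` (+ ★ G2 + §§2–5) -/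

set_option synthInstance.maxHeartbeats 400000 in
set_option maxHeartbeats 8000000 in
/-- **T4 ⇐ FLOOR — the served stub `stub_FTF2iff' : StubFTF2iff'` of `Cruxes/H413/Lines/a3_liu413.lean` (v10.1 :410) FROM THE FLOOR ROWS III-2 (a)∃ (`hdictE`)
and III-2 (c)⇐ (`hocc`)** — binder texts = the registered floor stubs `stub_oscillatorTriple_dictionaryExistence` (:267) / `stub_admissible_occursInH1` (:306)
VERBATIM (A-p07's `hdictE` / `hocc`).  At `n = 3`, for every `τ'` and every weight-one triple `t` with `ε` COFINITE:
(⇐) `Parity t` ⇒ admissible (★ `stubG2_holds`) ⇒ occurs (`hocc`); (⇒) `ω_V(t)` occurs ⇒ irreducible (§3) ⇒ `≅ ω_V(t')`, `t'` admissible weight-one (`hdictE`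
through `stub_dictionaryExistenceAtPin_of_dictionaryExistence`) ⇒ labels agree up to the `ε`-lines (§4) ⇒ `ε_t = ε_{t'}` because BOTH lines are honest
(§5: the guard for `t`, admissibility for `t'`; `Rep.locF_toFun`) ⇒ `t = t'` is admissible ⇒ `Parity t` (G2 ⇒).  HONEST LABEL: this closes the served T4
stub from the floor (item 24833's served set shrinks); it is NOT a floor reduction and adds no citation — `StubFTF2iff'` itself, as Rogawski's theorem, stays
FACT ∞.  HC_CM is proved only modulo the 7 printed citations until rung 0 closes.
[cite: Rogawski1990, Thm. 14.6.4 (p. 244)] [cite: Rogawski1992, Thm. 1.1] [cite: Marshall2014, §3.4]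
[cite: Liu2021, Def. 4.11 (l. 2088); Def. 4.12; proof of Prop. 4.13 (l. 2145); Thm. 4.18 (2) with proof l. 2270; App. D Lem. D.1 (1), (3)]
[cite: GelbartRogawski1991, Intro p. 447 L6–8; Thm. 5.1.1 p. 465] -/
theorem stubFTF2iff'_of_floor
    (hdictE :
    ∀ (hDel : Literature.AlgebraicGeometry.ShimuraVarieties.UnitaryCanonicalModel.canonicalModel_exists_printed)
      (F : HodgeCM.CMField) [IsGalois ℚ F] (h6 : 6 ≤ Module.finrank ℚ F) {ι₁ : F →+* ℂ} (V : HodgeCM.HermSpace3 F ι₁) (a₀ : RealScalar F)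
      (Φ : CMType F) (hΦ : ι₁ ∈ Φ.1) (i : (I V (repAt a₀) (muLiu ι₁ GramClass.rep))),
      oscillatorTriple_dictionaryExistence (((uniformOmegaRep (Summit.HodgeConjecture.CorCM.DelRec.exists_recordSystem_of_printed hDel) ⟨HodgeCM.CMField.K F⟩ ι₁ ⟨HodgeCM.HermSpace3.Hm V, HodgeCM.HermSpace3.isHermitian V, HodgeCM.HermSpace3.signature_ι₁ V, HodgeCM.HermSpace3.posDef_of_ne V⟩ Φ e₁ (frameD V) (frameD_real V) (frameD_ne V) (ιVE V) (2 * imagUnit (HodgeCM.CMField.K F))⁻¹ (fun _ _ => (Rep.update ↥(maximalRealSubfield (HodgeCM.CMField.K F)) (imagUnitSq (HodgeCM.CMField.K F)) (Rep.ofLineOf ↥(maximalRealSubfield (HodgeCM.CMField.K F)) (imagUnitSq (HodgeCM.CMField.K F))) (locF ↥(maximalRealSubfield (HodgeCM.CMField.K F)) (imagUnitSq (HodgeCM.CMField.K F)) (realUnit ⟨HodgeCM.CMField.K F⟩ (repAt a₀ (Sigma.fst i)).1 (repAt a₀ (Sigma.fst i)).2.1 (repAt a₀ (Sigma.fst i)).2.2))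 (realUnit ⟨HodgeCM.CMField.K F⟩ (repAt a₀ (Sigma.fst i)).1 (repAt a₀ (Sigma.fst i)).2.1 (repAt a₀ (Sigma.fst i)).2.2) rfl)))).prop413Data ((liuDictionaryPin exists_isReal_hodgeModel_holds hodgePQ_independent_of_hodgeModel_holds BallQuotient.ballQuotientUniformised_holds (cmAbelianVarietyRealised_of_eigenbasis exists_isReal_hodgeModel_holds hodgePQ_independent_of_hodgeModel_holds cmAbelianVarietyEigenbasisRealised_holds) Literature.NumberTheory.Transcendental.arapura2012_cor_15_4_6_holds V (I V (repAt a₀) (muLiu ι₁ GramClass.rep)) (line V (repAt a₀) (muLiu ι₁ GramClass.rep)))).H))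
    (hocc :
    ∀ (hDel : Literature.AlgebraicGeometry.ShimuraVarieties.UnitaryCanonicalModel.canonicalModel_exists_printed)
      (F : HodgeCM.CMField) [IsGalois ℚ F] (h6 : 6 ≤ Module.finrank ℚ F) {ι₁ : F →+* ℂ} (V : HodgeCM.HermSpace3 F ι₁) (a₀ : RealScalar F)
      (Φ : CMType F) (hΦ : ι₁ ∈ Φ.1) (i : (I V (repAt a₀) (muLiu ι₁ GramClass.rep))),
      admissible_occursInH1 (((uniformOmegaRep (Summit.HodgeConjecture.CorCM.DelRec.exists_recordSystem_of_printed hDel) ⟨HodgeCM.CMField.K F⟩ ι₁ ⟨HodgeCM.HermSpace3.Hm V, HodgeCM.HermSpace3.isHermitian V, HodgeCM.HermSpace3.signature_ι₁ V, HodgeCM.HermSpace3.posDef_of_ne V⟩ Φ e₁ (frameD V) (frameD_real V) (frameD_ne V) (ιVE V) (2 * imagUnit (HodgeCM.CMField.K F))⁻¹ (fun _ _ => (Rep.update ↥(maximalRealSubfield (HodgeCM.CMField.K F)) (imagUnitSq (HodgeCM.CMField.K F)) (Rep.ofLineOf ↥(maximalRealSubfield (HodgeCM.CMField.K F)) (imagUnitSq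 (HodgeCM.CMField.K F))) (locF ↥(maximalRealSubfield (HodgeCM.CMField.K F)) (imagUnitSq (HodgeCM.CMField.K F)) (realUnit ⟨HodgeCM.CMField.K F⟩ (repAt a₀ (Sigma.fst i)).1 (repAt a₀ (Sigma.fst i)).2.1 (repAt a₀ (Sigma.fst i)).2.2)) (realUnit ⟨HodgeCM.CMField.K F⟩ (repAt a₀ (Sigma.fst i)).1 (repAt a₀ (Sigma.fst i)).2.1 (repAt a₀ (Sigma.fst i)).2.2) rfl)))).prop413Data ((liuDictionaryPin exists_isReal_hodgeModel_holds hodgePQ_independent_of_hodgeModel_holds BallQuotient.ballQuotientUniformised_holds (cmAbelianVarietyRealised_of_eigenbasis exists_isReal_hodgeModel_holds hodgePQ_independent_of_hodgeModel_holds cmAbelianVarietyEigenbasisRealised_holds) Literature.NumberTheory.Transcendental.arapura2012_cor_15_4_6_holds V (I V (repAt a₀) (muLiu ι₁ GramClass.rep)) (line V (repAt a₀) (muLiu ι₁ GramClass.rep)))).H)) :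
    StubFTF2iff' := by
  intro hDel F _ h6 ι₁ V a₀ Φ hΦ i hn τ' t hfin hw
  refine ⟨fun hoccω => ?_, fun hpar => stubFTF2iff'_mpr_of_floor hocc hDel F h6 V a₀ Φ hΦ i hn τ' t hw hpar⟩
  -- `ω_V(t)` is irreducible, hence `≅ ω_V(t')` for an admissible weight-one `t'` (floor row III-2 (a)∃ at the pin)
  have hirr : (rhoTriple (datum413 hDel F V a₀ Φ i) t).IsIrreducible := isIrreducible_rhoTriple_datum413 hDel F h6 V a₀ Φ hΦ i t hw
  obtain ⟨t', f, hf⟩ :=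
    stub_dictionaryExistenceAtPin_of_dictionaryExistence hdictE hDel F h6 V a₀ Φ hΦ i hn τ' _ (rhoTriple (datum413 hDel F V a₀ Φ i) t) hirr hoccω
  -- label rigidity on the weight-one family: `μ`, the `ε`-LINES and `χ` agree
  obtain ⟨hμ, hlines, hχ⟩ := sep_weightOne_datum413 hDel F h6 V a₀ Φ hΦ i t t'.1 hw t'.2.1 hirr.nontrivial ⟨f, hf⟩
  -- both lines are honest (the guard for `t`, admissibility for `t'`), so the `ε`-labels themselves agree
  have hε : t.ε = t'.1.ε :=
    (((Rep.update ↥(maximalRealSubfield (HodgeCM.CMField.K F)) (imagUnitSq (HodgeCM.CMField.K F)) (Rep.ofLineOf ↥(maximalRealSubfield (HodgeCM.CMField.K F)) (imagUnitSq (HodgeCM.CMField.K F))) (locF ↥(maximalRealSubfield (HodgeCM.CMField.K F)) (imagUnitSq (HodgeCM.CMField.K F)) (realUnit ⟨HodgeCM.CMField.K F⟩ (repAt a₀ (Sigma.fst i)).1 (repAt a₀ (Sigma.fst i)).2.1 (repAt a₀ (Sigma.fst i)).2.2)) (realUnit ⟨HodgeCM.CMField.K F⟩ (repAt a₀ (Sigma.fst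 i)).1 (repAt a₀ (Sigma.fst i)).2.1 (repAt a₀ (Sigma.fst i)).2.2) rfl).locF_toFun t.ε (exists_locF_eq_of_epsCofinite hDel F V a₀ Φ i t hfin)).symm.trans hlines).trans
      ((Rep.update ↥(maximalRealSubfield (HodgeCM.CMField.K F)) (imagUnitSq (HodgeCM.CMField.K F)) (Rep.ofLineOf ↥(maximalRealSubfield (HodgeCM.CMField.K F)) (imagUnitSq (HodgeCM.CMField.K F))) (locF ↥(maximalRealSubfield (HodgeCM.CMField.K F)) (imagUnitSq (HodgeCM.CMField.K F)) (realUnit ⟨HodgeCM.CMField.K F⟩ (repAt a₀ (Sigma.fst i)).1 (repAt a₀ (Sigma.fst i)).2.1 (repAt a₀ (Sigma.fst i)).2.2)) (realUnit ⟨HodgeCM.CMField.K F⟩ (repAt a₀ (Sigma.fst i)).1 (repAt a₀ (Sigma.fst i)).2.1 (repAt a₀ (Sigma.fst i)).2.2) rfl).locF_toFun t'.1.ε (exists_locF_eq_of_isAdmissible hDel F V a₀ Φ i t'.1 t'.2.2))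
  -- hence `t = t'` is admissible, and `Parity t` is G2 (⇒)
  have ht : t = t'.1 := by
    obtain ⟨μ₁, h₁, ε₁, χ₁⟩ := t
    obtain ⟨⟨μ₂, h₂, ε₂, χ₂⟩, hw₂⟩ := t'
    dsimp only at hμ hε hχ ⊢
    subst hμ hε hχ
    rfl
  exact (stubG2_holds hDel F h6 V a₀ Φ hΦ i t).mp (ht ▸ t'.2.2)

end Summit.HodgeConjecture.HodgeConjecture.Theorems

end
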